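import Summits.BirchSwinnertonDyer.BirchSwinnertonDyer.Theorems.GenusKolyvaginAtTwoK4PosOffCutNonPhantomAtTwoMult
import HarnessLib

/-!
# Route `GenusKolyvaginAtTwo`, kernel item `K4Neg` (stmt-BirchSwinnertonDyer-31526), LINE 34 «twin_bsd_road⁻», stub F4″ `stub_offCutNonPhantomAtTwo`:
# THE `2`-MULTIPLICATIVE SLICE IS A THEOREM (the `Δ < 0` reading of the sign-free core)

Width seat `bsd-line-gk2-p5` g41 (cell `bsd-f1-sign2`), `--supports stmt-BirchSwinnertonDyer-31526 --as helper`.  ONE THEOREM (no definition, no named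
fact, no `sorry`): LINE 34's F4″ with its binders VERBATIM (`Δ < 0`, `#Sel₂ = 4`, …) plus `v₂ ∋ 2` multiplicative, by the sign-free core
`nonPhantomAtTwo_baseChange_of_hasMultiplicativeReductionAt_two` (companion file `…K4PosOffCutNonPhantomAtTwoMult`, which carries the mathematics and the
references).  **BSD is NOT proved by this file; `K4Neg` is NOT proved; nothing is closed.**
-/

set_option linter.dupNamespace false -- tree convention: `Summit.BirchSwinnertonDyer.BirchSwinnertonDyer.Theorems` (summit = sub-problem)
set_option autoImplicit false

noncomputable section

open scoped Classical

namespace Summit.BirchSwinnertonDyer.BirchSwinnertonDyer.Theorems.GenusExact.Lw2PhantomExclusion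

open WeierstrassCurve NumberField Field IsDedekindDomain
open Literature.NumberTheory.EllipticCurves Literature.NumberTheory.GaloisRepresentations

/-- **LINE 34 stub F4″ `stub_offCutNonPhantomAtTwo` (K₄⁻) ON THE `2`-MULTIPLICATIVE SLICE — binders VERBATIM, plus `v₂ ∋ 2` multiplicative.**  For
`E/ℚ` on the off-cut K₄⁻ cell that is multiplicative at `2`, and an admissible frame `K` with `2` split: every phantom class of `H¹(K, E[2^L])` (`L ≥ 1`)
Kummer at the places over `2` is zero.  BSD / `K4Neg` NOT proved. [cite: LawsonWuthrich2016, §7.1 and §8] [cite: SilvermanATAEC1994, proof of Prop. V.6.1 (PDF p. 411)] -/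
theorem k4Neg_offCutNonPhantomAtTwo_of_hasMultiplicativeReductionAt_two
    (W : WeierstrassCurve ℚ) [W.IsElliptic] [W.IsGloballyMinimal] [NeZero (W.conductorNorm ℤ)]
    (_hcm : ¬ W.HasCM) (_hr0 : W.analyticRank = 0) (hρ : ∀ n : ℕ, 0 < n → W.HasSurjectiveModNGaloisRep ((2 : ℤ) ^ n))
    (hT : Odd W.tamagawaProduct) (_hneg : W.Δ < 0) (_h4 : Nat.card (W.selmerGroup 2) = 4)
    (_hoff : ¬ ∃ v : HeightOneSpectrum (𝓞 ℚ), ((2 : ℕ) : 𝓞 ℚ) ∉ v.asIdeal ∧ ((W.conductorNorm ℤ : ℕ) : 𝓞 ℚ) ∈ v.asIdeal ∧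
      W.HasMultiplicativeReductionAt v)
    (K : Type) [Field K] [NumberField K] (hIQ : IsImaginaryQuadratic K) (hodd : Odd (NumberField.discr K))
    (_h3 : NumberField.discr K ≠ -3) (_hHe : SatisfiesHeegnerHypothesis (W.conductorNorm ℤ) K)
    (hsq1 : ¬ IsSquare ((NumberField.discr K : ℚ) * -|W.Δ|)) (hsq2 : ¬ IsSquare ((NumberField.discr K : ℚ) * (-(2 * |W.Δ|))))
    (h2K : ((Ideal.span {(2 : ℤ)}).primesOver (𝓞 K)).ncard = 2)
    {v₂ : HeightOneSpectrum (𝓞 ℚ)} (h2v : ((2 : ℕ) : 𝓞 ℚ) ∈ v₂.asIdeal) (hmult : W.HasMultiplicativeReductionAt v₂) :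
    ∀ (L : ℕ), 1 ≤ L → ∀ z : galH1Torsion (W.baseChange K) ((2 ^ L : ℕ) : ℤ),
      (∀ ρ' ∈ torsionFixing (W.baseChange K) ((2 ^ L : ℕ) : ℤ), h1Eval (W.baseChange K) ((2 ^ L : ℕ) : ℤ) z ρ' = 0) →
      (∀ w : HeightOneSpectrum (𝓞 K), ((2 : ℕ) : 𝓞 K) ∈ w.asIdeal →
        z ∈ selmerLocalKer (W.baseChange K) (w.adicCompletion K) ((2 ^ L : ℕ) : ℤ)) → z = 0 :=
  nonPhantomAtTwo_baseChange_of_hasMultiplicativeReductionAt_two W hT hρ K hIQ hodd hsq1 hsq2 h2K h2v hmult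

end Summit.BirchSwinnertonDyer.BirchSwinnertonDyer.Theorems.GenusExact.Lw2PhantomExclusion

end
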